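import Mathlib
import Literature.LinearAlgebra.Matrix.RankMinors
import Summits.PneNP.PneNP.Theorems.CnfIdealGenLengthRankDefectRepresentationsTwoFamilyCutDomination
import Summits.PneNP.PneNP.Theorems.CnfIdealGenLengthRankDefectRepresentationsDoubleMaxCutTwoClasses
import Summits.PneNP.PneNP.Theorems.CnfIdealGenLengthRankDefectRepresentationsStripCompletion

/-!
# Crux `RankDefectRepresentations` (stmt-PneNP-18923), line `rank-dehn-ladder`: the SUB-ANCHOR STRIP LEMMA — the singly-colliding
# strips of the anchor method cost only LINEAR rank (lead g11, memo `Lines/rank-dehn-ladder-g11.md` §8)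

Setting of the anchor method (`Theorems/…AnchorExtrapolation`, p677763): rows and columns carry two colours (`colourI`, `colourJ`); an entry
is VISIBLE when both colours differ; `(X₀, Y₀)` is a MAXIMAL ANCHOR — an invertible co-rectangular `r`-minor such that no invertible
co-rectangular `(r+1)`-minor exists.  Anchor extrapolation explains `D` on (good rows) × (good columns); Theorem A (p678858) then paid `O(c)`
for EACH of the `≤ 4c` colliding label strips, whence its quadratic constant.  This file proves that the strips colliding with the anchor in
ONE family only are in fact cheap IN TOTAL:

`exists_rowStrips_completion`: there is `L` of rank `≤ 9r` with `L = D` at every visible entry whose row is J-good (J-colour not among the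
J-colours of the anchor columns — its I-colour is arbitrary, colliding or not) and whose column is good (colours not among those of the anchor
rows).

Proof (SUB-ANCHOR TRICK).  For an I-colour `p` let `m_p` be the number of anchor columns of I-colour `p`; the other `s_p = r − m_p` anchor
columns contain an invertible `s_p`-minor `M_p = D[X_p, Y_p]` of the anchor (`exists_subanchor`).  Extrapolate every J-good row `x` of I-colour
`p` through ITS sub-anchor: `E[x,y] = D[x,Y_p] M_p⁻¹ D[X_p,y]`; all these rows lie in the span of the `r` anchor rows, so `rank E ≤ r`.  For a
set `T` of J-colours, any `(m_p+1)`-minor of the residual block (rows: I-colour `p`, J-colour in `T`; columns: good, I-colour `≠ p`, J-colour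
`∉ T`) is the Schur complement in a BORDERED `(r+1)`-minor `[[M_p, B],[C, ·]]` of `D` which is co-rectangular, hence singular by maximality
(`Matrix.det_fromBlocks₁₁`); so every such block has rank `≤ m_p` (`rank_le_of_det_submatrix_eq_zero`), the residual strip is a one-family
instance with cuts `≤ 2 m_p`, and g7's `exists_blockDiagonal_of_cuts_le` completes it at rank `≤ 8 m_p`.  Summing, `Σ_p m_p = r`, so
`rank L ≤ r + 8r`.  HONEST FRAMING: a lemma toward the (open) LINEAR form of the 2D max-cut decomposition; it does not close
`stub_doubleMaxCutDecomposition`; P ≠ NP is not moved; F-N2 is a FRONTIER formal rung.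
-/

set_option linter.dupNamespace false -- `Summit.PneNP.PneNP.…`: summit = sub-problem name (D-0017)

namespace Summit.PneNP.PneNP.Theorems.CnfIdealGenLengthRankDefectRepresentationsAnchorStrips

open Matrix
open Summit.PneNP.PneNP.Theorems.CnfIdealGenLengthRankDefectRepresentationsTwoFamilyCutDomination (colourI colourJ)
open Summit.PneNP.PneNP.Theorems.CnfIdealGenLengthRankDefectRepresentationsDoubleMaxCutTwoClasses (exists_blockDiagonal_of_cuts_le)
open Summit.PneNP.PneNP.Theorems.CnfIdealGenLengthRankDefectRepresentationsMergeLowerBound (rank_add_le' rank_sub_le' rank_sum_le')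
open Summit.PneNP.PneNP.Theorems.CnfIdealGenLengthRankDefectRepresentationsStripCompletion (rank_mask_le)
open Literature.LinearAlgebra.Matrix (exists_det_submatrix_ne_zero_of_le_rank rank_le_of_det_submatrix_eq_zero)

variable {K : Type} [Field K] {n n' : ℕ} {ι ι' : Type} [Fintype ι] [Fintype ι'] [DecidableEq ι] [DecidableEq ι']

section SubAnchor

variable (col : ι' → Fin n ⊕ Fin n' → Bool) (D : Matrix ι ι' K)

omit [Fintype ι] [Fintype ι'] [DecidableEq ι] [DecidableEq ι'] in
/-- **Sub-anchor.**  Inside an invertible `r`-minor `D[X₀,Y₀]`, the anchor columns whose I-colour is not `p` (there are `s = r − m_p` of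
them) contain an invertible `s`-minor `D[X₀ ∘ rs, Y₀ ∘ cs]`. -/
theorem exists_subanchor {r : ℕ} (X₀ : Fin r → ι) (Y₀ : Fin r → ι') (hu : IsUnit (D.submatrix X₀ Y₀).det)
    (p : Fin n → Bool) :
    ∃ (s : ℕ) (rs : Fin s → Fin r) (cs : Fin s → Fin r),
      s + (Finset.univ.filter fun j => colourI (col (Y₀ j)) = p).card = r ∧
      (∀ a, colourI (col (Y₀ (cs a))) ≠ p) ∧ Function.Injective rs ∧
      IsUnit (D.submatrix (X₀ ∘ rs) (Y₀ ∘ cs)).det := by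
  classical
  set M : Matrix (Fin r) (Fin r) K := D.submatrix X₀ Y₀ with hM
  set S : Finset (Fin r) := Finset.univ.filter fun j => colourI (col (Y₀ j)) ≠ p with hS
  set s := S.card with hs
  let e : Fin s ↪o Fin r := S.orderEmbOfFin rfl
  have he : ∀ a, e a ∈ S := fun a => Finset.orderEmbOfFin_mem S rfl a
  -- the selected columns are linearly independent, so the `r × s` matrix has rank `s`
  set M' : Matrix (Fin r) (Fin s) K := M.submatrix id e with hM'
  have hcols : LinearIndependent K M.col := Matrix.linearIndependent_cols_iff_isUnit.2 ((Matrix.isUnit_iff_isUnit_det _).2 hu)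
  have hcols' : LinearIndependent K M'.col := by
    have : M'.col = M.col ∘ e := by
      funext a; ext i; rfl
    rw [this]
    exact hcols.comp _ e.injective
  have hrank : s ≤ M'.rank := by
    rw [Matrix.rank_eq_finrank_span_cols, finrank_span_eq_card hcols', Fintype.card_fin]
  obtain ⟨rs, cs, hrs, -, hdet⟩ := exists_det_submatrix_ne_zero_of_le_rank M' hrank
  refine ⟨s, rs, fun a => e (cs a), ?_, ?_, hrs, ?_⟩
  · have h := Finset.card_filter_add_card_filter_not (s := (Finset.univ : Finset (Fin r)))
      (fun j => colourI (col (Y₀ j)) ≠ p)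
    simp only [Finset.card_univ, Fintype.card_fin, not_not] at h
    simpa [hs, hS] using h
  · intro a
    have := he (cs a)
    rw [hS, Finset.mem_filter] at this
    exact this.2
  · have : D.submatrix (X₀ ∘ rs) (Y₀ ∘ fun a => e (cs a)) = M'.submatrix rs cs := by
      ext a b; rfl
    rw [this]
    exact isUnit_iff_ne_zero.2 hdet

end SubAnchor

section Strips

variable (row : ι → Fin n ⊕ Fin n' → Bool) (col : ι' → Fin n ⊕ Fin n' → Bool) (D : Matrix ι ι' K)

/-- **THE SUB-ANCHOR STRIP LEMMA.**  For a maximal anchor `(X₀, Y₀)` of size `r` there is a matrix `L` of rank `≤ 9r` agreeing with `D` at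
every visible entry `(x,y)` whose row is J-good (its J-colour is not the J-colour of an anchor column; its I-colour is unrestricted) and whose
column is good (its colours are not those of an anchor row). -/
theorem exists_rowStrips_completion {r : ℕ} (X₀ : Fin r → ι) (Y₀ : Fin r → ι')
    (hco : ∀ i j, colourI (row (X₀ i)) ≠ colourI (col (Y₀ j)) ∧ colourJ (row (X₀ i)) ≠ colourJ (col (Y₀ j)))
    (hu : IsUnit (D.submatrix X₀ Y₀).det)
    (hmax : ∀ (X' : Fin (r + 1) → ι) (Y' : Fin (r + 1) → ι'),
      (∀ i j, colourI (row (X' i)) ≠ colourI (col (Y' j)) ∧ colourJ (row (X' i)) ≠ colourJ (col (Y' j))) →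
      ¬ IsUnit (D.submatrix X' Y').det) :
    ∃ L : Matrix ι ι' K, L.rank ≤ 9 * r ∧
      ∀ x y, colourI (row x) ≠ colourI (col y) → colourJ (row x) ≠ colourJ (col y) →
        colourJ (row x) ∉ Finset.univ.image (fun j => colourJ (col (Y₀ j))) →
        colourI (col y) ∉ Finset.univ.image (fun i => colourI (row (X₀ i))) →
        colourJ (col y) ∉ Finset.univ.image (fun i => colourJ (row (X₀ i))) →
        L x y = D x y := by
  classical
  -- abbreviations
  let cIr : ι → (Fin n → Bool) := fun x => colourI (row x)
  let cJr : ι → (Fin n' → Bool) := fun x => colourJ (row x)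
  let cIc : ι' → (Fin n → Bool) := fun y => colourI (col y)
  let cJc : ι' → (Fin n' → Bool) := fun y => colourJ (col y)
  set QJ : Finset (Fin n' → Bool) := Finset.univ.image (fun j => cJc (Y₀ j)) with hQJ
  set PI' : Finset (Fin n → Bool) := Finset.univ.image (fun i => cIr (X₀ i)) with hPI'
  set QJ' : Finset (Fin n' → Bool) := Finset.univ.image (fun i => cJr (X₀ i)) with hQJ'
  let Jgood : ι → Prop := fun x => cJr x ∉ QJ
  let goodC : ι' → Prop := fun y => cIc y ∉ PI' ∧ cJc y ∉ QJ'
  let m : (Fin n → Bool) → ℕ := fun p => (Finset.univ.filter fun j => cIc (Y₀ j) = p).card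
  -- sub-anchors for every I-colour
  have hsub := fun p => exists_subanchor col D X₀ Y₀ hu p
  choose s rs cs hsm hcs hrs hunit using hsub
  -- the sub-anchor minors; the extrapolation `E = G' * H` through the row's own sub-anchor
  let M : (p : Fin n → Bool) → Matrix (Fin (s p)) (Fin (s p)) K := fun p => D.submatrix (X₀ ∘ rs p) (Y₀ ∘ cs p)
  -- coefficient of the sub-anchor row `b` in the extrapolation of row `x` (I-colour `p`)
  let w : (p : Fin n → Bool) → ι → Fin (s p) → K := fun p x b => ∑ a : Fin (s p), D x (Y₀ (cs p a)) * (M p)⁻¹ a b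
  set H : Matrix (Fin r) ι' K := Matrix.of fun i y => if goodC y then D (X₀ i) y else 0 with hH
  set G' : Matrix ι (Fin r) K := Matrix.of fun x i =>
    if Jgood x then ∑ b : Fin (s (cIr x)), (if i = rs (cIr x) b then w (cIr x) x b else 0) else 0 with hG'
  set E : Matrix ι ι' K := G' * H with hE
  have hErank : E.rank ≤ r :=
    (Matrix.rank_mul_le_right G' H).trans ((Matrix.rank_le_card_height H).trans (le_of_eq (Fintype.card_fin r)))
  -- explicit form of `E` at a J-good row of I-colour `p` and a good column
  have hEval : ∀ p x y, cIr x = p → Jgood x → goodC y →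
      E x y = ∑ a : Fin (s p), ∑ b : Fin (s p), D x (Y₀ (cs p a)) * (M p)⁻¹ a b * D (X₀ (rs p b)) y := by
    intro p x y hxp hxg hyg
    subst hxp
    have h1 : E x y = ∑ i : Fin r, (∑ b : Fin (s (cIr x)), (if i = rs (cIr x) b then w (cIr x) x b else 0)) * D (X₀ i) y := by
      rw [hE, Matrix.mul_apply]
      refine Finset.sum_congr rfl fun i _ => ?_
      simp only [hG', hH, Matrix.of_apply, if_pos hxg, if_pos hyg]
    have h2 : ∀ i : Fin r, (∑ b : Fin (s (cIr x)), (if i = rs (cIr x) b then w (cIr x) x b else 0)) * D (X₀ i) y =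
        ∑ b : Fin (s (cIr x)), (if i = rs (cIr x) b then w (cIr x) x b * D (X₀ i) y else 0) := by
      intro i
      rw [Finset.sum_mul]
      refine Finset.sum_congr rfl fun b _ => ?_
      split_ifs <;> simp
    have h3 : ∀ b : Fin (s (cIr x)), (∑ i : Fin r, (if i = rs (cIr x) b then w (cIr x) x b * D (X₀ i) y else 0)) =
        w (cIr x) x b * D (X₀ (rs (cIr x) b)) y := by
      intro b
      rw [Finset.sum_ite_eq' Finset.univ (rs (cIr x) b)]
      simp
    rw [h1, Finset.sum_congr rfl fun i _ => h2 i, Finset.sum_comm, Finset.sum_congr rfl fun b _ => h3 b]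
    -- unfold `w` and reorder the double sum
    simp only [w, Finset.sum_mul]
    rw [Finset.sum_comm]
  -- the residual and its strip blocks
  set R : Matrix ι ι' K := D - E with hR
  -- KEY: every `(m_p + 1)`-minor of a residual strip block vanishes (bordered minor + maximality)
  have hblock : ∀ (p : Fin n → Bool) (T : Finset (Fin n' → Bool)) (bT : Bool),
      (Matrix.of fun x y =>
        if (cIr x = p ∧ Jgood x ∧ (decide (cJr x ∈ T) = bT)) ∧ (goodC y ∧ cIc y ≠ p ∧ (decide (cJc y ∈ T) = !bT))
        then R x y else 0).rank ≤ m p := by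
    intro p T bT
    set Blk : Matrix ι ι' K := Matrix.of fun x y =>
        if (cIr x = p ∧ Jgood x ∧ (decide (cJr x ∈ T) = bT)) ∧ (goodC y ∧ cIc y ≠ p ∧ (decide (cJc y ∈ T) = !bT))
        then R x y else 0 with hBlk
    have hm : s p + (m p + 1) = r + 1 := by
      have h := hsm p
      show s p + ((Finset.univ.filter fun j => colourI (col (Y₀ j)) = p).card + 1) = r + 1
      omega
    apply rank_le_of_det_submatrix_eq_zero
    intro rr cc
    -- if some selected row / column lies outside the block, the minor has a zero row / column
    by_cases hrow : ∀ a, cIr (rr a) = p ∧ Jgood (rr a) ∧ (decide (cJr (rr a) ∈ T) = bT)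
    swap
    · push Not at hrow
      obtain ⟨a, ha⟩ := hrow
      refine Matrix.det_eq_zero_of_row_eq_zero a fun a' => ?_
      simp only [Matrix.submatrix_apply, hBlk, Matrix.of_apply]
      rw [if_neg]
      rintro ⟨⟨h1, h2, h3⟩, -⟩
      exact ha h1 h2 h3
    by_cases hcol : ∀ a', goodC (cc a') ∧ cIc (cc a') ≠ p ∧ (decide (cJc (cc a') ∈ T) = !bT)
    swap
    · push Not at hcol
      obtain ⟨a', ha'⟩ := hcol
      refine Matrix.det_eq_zero_of_column_eq_zero a' fun a => ?_
      simp only [Matrix.submatrix_apply, hBlk, Matrix.of_apply]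
      rw [if_neg]
      rintro ⟨-, ⟨h1, h2, h3⟩⟩
      exact ha' h1 h2 h3
    -- the bordered minor
    set Bm : Matrix (Fin (s p)) (Fin (m p + 1)) K := Matrix.of fun b a' => D (X₀ (rs p b)) (cc a') with hBm
    set Cm : Matrix (Fin (m p + 1)) (Fin (s p)) K := Matrix.of fun a b => D (rr a) (Y₀ (cs p b)) with hCm
    set Dm : Matrix (Fin (m p + 1)) (Fin (m p + 1)) K := Matrix.of fun a a' => D (rr a) (cc a') with hDm
    set X' : Fin (s p) ⊕ Fin (m p + 1) → ι := Sum.elim (X₀ ∘ rs p) rr with hX'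
    set Y' : Fin (s p) ⊕ Fin (m p + 1) → ι' := Sum.elim (Y₀ ∘ cs p) cc with hY'
    have hblocks : D.submatrix X' Y' = Matrix.fromBlocks (M p) Bm Cm Dm := by
      ext (b | a) (b' | a') <;> rfl
    have hco' : ∀ u v, colourI (row (X' u)) ≠ colourI (col (Y' v)) ∧ colourJ (row (X' u)) ≠ colourJ (col (Y' v)) := by
      rintro (b | a) (b' | a') <;>
        simp only [hX', hY', Sum.elim_inl, Sum.elim_inr, Function.comp_apply]
      · exact hco (rs p b) (cs p b')
      · -- anchor row vs good column
        obtain ⟨⟨hg1, hg2⟩, -, -⟩ := hcol a'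
        exact ⟨fun h => hg1 (Finset.mem_image.2 ⟨rs p b, Finset.mem_univ _, h⟩),
          fun h => hg2 (Finset.mem_image.2 ⟨rs p b, Finset.mem_univ _, h⟩)⟩
      · -- strip row vs sub-anchor column
        obtain ⟨h1, h2, -⟩ := hrow a
        refine ⟨fun h => hcs p b' ?_, fun h => h2 ?_⟩
        · rw [← h]; exact h1
        · show cJr (rr a) ∈ QJ
          rw [show cJr (rr a) = cJc (Y₀ (cs p b')) from h]
          exact Finset.mem_image.2 ⟨cs p b', Finset.mem_univ _, rfl⟩
      · -- strip row vs block column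
        obtain ⟨h1, -, h3⟩ := hrow a
        obtain ⟨-, h5, h6⟩ := hcol a'
        refine ⟨fun h => h5 ?_, fun h => ?_⟩
        · show colourI (col (cc a')) = p
          rw [← h]; exact h1
        · have e1 : decide (cJc (cc a') ∈ T) = bT := by
            rw [← h3]
            show decide (colourJ (col (cc a')) ∈ T) = decide (colourJ (row (rr a)) ∈ T)
            rw [h]
          rw [e1] at h6
          cases bT <;> simp at h6
    have hsing : (D.submatrix X' Y').det = 0 := by
      by_contra hne
      let e : Fin (r + 1) ≃ Fin (s p) ⊕ Fin (m p + 1) := (finCongr hm.symm).trans finSumFinEquiv.symm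
      have hdet : (D.submatrix (X' ∘ e) (Y' ∘ e)).det = (D.submatrix X' Y').det := by
        rw [show D.submatrix (X' ∘ e) (Y' ∘ e) = (D.submatrix X' Y').submatrix e e from rfl,
          Matrix.det_submatrix_equiv_self]
      refine hmax (X' ∘ e) (Y' ∘ e) (fun u v => hco' (e u) (e v)) ?_
      rw [hdet]
      exact isUnit_iff_ne_zero.2 hne
    haveI : Invertible (M p) := Matrix.invertibleOfIsUnitDet (M p) (hunit p)
    rw [hblocks, Matrix.det_fromBlocks₁₁] at hsing
    have hschur : (Dm - Cm * ⅟(M p) * Bm).det = 0 := by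
      rcases mul_eq_zero.1 hsing with h | h
      · exact ((hunit p).ne_zero h).elim
      · exact h
    -- the Schur complement IS the selected minor of the residual block
    have hSchurEq : Blk.submatrix rr cc = Dm - Cm * ⅟(M p) * Bm := by
      ext a a'
      have hc : (cIr (rr a) = p ∧ Jgood (rr a) ∧ decide (cJr (rr a) ∈ T) = bT) ∧
          (goodC (cc a') ∧ cIc (cc a') ≠ p ∧ decide (cJc (cc a') ∈ T) = !bT) := ⟨hrow a, hcol a'⟩
      have hRa : R (rr a) (cc a') = D (rr a) (cc a') -
          ∑ a₁ : Fin (s p), ∑ b : Fin (s p), D (rr a) (Y₀ (cs p a₁)) * (M p)⁻¹ a₁ b * D (X₀ (rs p b)) (cc a') := by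
        rw [hR, Matrix.sub_apply, hEval p (rr a) (cc a') hc.1.1 hc.1.2.1 hc.2.1]
      have hRHS : (Cm * ⅟(M p) * Bm) a a' =
          ∑ b : Fin (s p), ∑ a₁ : Fin (s p), D (rr a) (Y₀ (cs p a₁)) * (M p)⁻¹ a₁ b * D (X₀ (rs p b)) (cc a') := by
        simp only [Matrix.mul_apply, hCm, hBm, Matrix.of_apply, Matrix.invOf_eq_nonsing_inv, Finset.sum_mul]
      rw [Matrix.submatrix_apply, hBlk, Matrix.of_apply, if_pos hc, hRa, Matrix.sub_apply, hRHS, Finset.sum_comm]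
      simp only [hDm, Matrix.of_apply]
    rw [hSchurEq]
    exact hschur
  -- the residual strips as one-family instances, and their completions
  have hstrip : ∀ p : Fin n → Bool, ∃ Lp : Matrix ι ι' K, Lp.rank ≤ 8 * m p ∧
      ∀ x y, cJr x ≠ cJc y → Lp x y = if (cIr x = p ∧ Jgood x) ∧ (goodC y ∧ cIc y ≠ p) then R x y else 0 := by
    intro p
    set Rp : Matrix ι ι' K := Matrix.of fun x y => if (cIr x = p ∧ Jgood x) ∧ (goodC y ∧ cIc y ≠ p) then R x y else 0
      with hRp
    have hcut : ∀ T : Finset (Fin n' → Bool),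
        (Matrix.of fun x y => if cJr x ∈ T ∧ cJc y ∉ T then Rp x y else 0).rank +
          (Matrix.of fun x y => if cJr x ∉ T ∧ cJc y ∈ T then Rp x y else 0).rank ≤ 2 * m p := by
      intro T
      have e1 : (Matrix.of fun x y => if cJr x ∈ T ∧ cJc y ∉ T then Rp x y else 0) =
          Matrix.of fun x y =>
            if (cIr x = p ∧ Jgood x ∧ (decide (cJr x ∈ T) = true)) ∧ (goodC y ∧ cIc y ≠ p ∧ (decide (cJc y ∈ T) = !true))
            then R x y else 0 := by
        ext x y
        simp only [hRp, Matrix.of_apply, Bool.not_true, decide_eq_true_eq, decide_eq_false_iff_not]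
        by_cases a1 : cJr x ∈ T <;> by_cases a2 : cJc y ∈ T <;> by_cases a3 : cIr x = p <;> by_cases a4 : Jgood x <;>
          by_cases a5 : goodC y <;> by_cases a6 : cIc y ≠ p <;> simp [a1, a2, a3, a4, a5, a6]
      have e2 : (Matrix.of fun x y => if cJr x ∉ T ∧ cJc y ∈ T then Rp x y else 0) =
          Matrix.of fun x y =>
            if (cIr x = p ∧ Jgood x ∧ (decide (cJr x ∈ T) = false)) ∧ (goodC y ∧ cIc y ≠ p ∧ (decide (cJc y ∈ T) = !false))
            then R x y else 0 := by
        ext x y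
        simp only [hRp, Matrix.of_apply, Bool.not_false, decide_eq_true_eq, decide_eq_false_iff_not]
        by_cases a1 : cJr x ∈ T <;> by_cases a2 : cJc y ∈ T <;> by_cases a3 : cIr x = p <;> by_cases a4 : Jgood x <;>
          by_cases a5 : goodC y <;> by_cases a6 : cIc y ≠ p <;> simp [a1, a2, a3, a4, a5, a6]
      rw [e1, e2]
      have b1 := hblock p T true
      have b2 := hblock p T false
      omega
    obtain ⟨Rp', hRp'0, hRp'rank⟩ := exists_blockDiagonal_of_cuts_le cJr cJc Rp (2 * m p) hcut
    refine ⟨Rp - Rp', hRp'rank.trans (le_of_eq (by ring)), fun x y hxy => ?_⟩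
    rw [Matrix.sub_apply, hRp'0 x y hxy, sub_zero]
    simp only [hRp, Matrix.of_apply]
  choose Lp hLpr hLp using hstrip
  -- the glued completion
  refine ⟨E + ∑ p : Fin n → Bool, Lp p, ?_, ?_⟩
  · -- rank ≤ r + 8 Σ_p m_p = 9r
    have hsum : ∑ p : Fin n → Bool, m p = r := by
      have h := Finset.card_eq_sum_card_fiberwise (s := (Finset.univ : Finset (Fin r))) (t := (Finset.univ : Finset (Fin n → Bool)))
        (f := fun j => cIc (Y₀ j)) (fun _ _ => Finset.mem_univ _)
      rw [Finset.card_univ, Fintype.card_fin] at h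
      exact h.symm
    calc (E + ∑ p, Lp p).rank ≤ E.rank + (∑ p, Lp p).rank := rank_add_le' _ _
      _ ≤ r + ∑ p, (Lp p).rank := Nat.add_le_add hErank (rank_sum_le' _ _)
      _ ≤ r + ∑ p, 8 * m p := Nat.add_le_add_left (Finset.sum_le_sum fun p _ => hLpr p) r
      _ = 9 * r := by rw [← Finset.mul_sum, hsum]; ring
  · intro x y hI hJ hxQJ hyPI' hyQJ'
    have hxg : Jgood x := hxQJ
    have hyg : goodC y := ⟨hyPI', hyQJ'⟩
    rw [Matrix.add_apply, Matrix.sum_apply]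
    rw [Finset.sum_congr rfl fun p _ => hLp p x y hJ]
    have : (∑ p : Fin n → Bool, if (cIr x = p ∧ Jgood x) ∧ (goodC y ∧ cIc y ≠ p) then R x y else 0) = R x y := by
      rw [Finset.sum_congr rfl fun p _ => show
          (if (cIr x = p ∧ Jgood x) ∧ (goodC y ∧ cIc y ≠ p) then R x y else 0) = (if cIr x = p then R x y else 0) by
            by_cases h : cIr x = p
            · have hne : cIc y ≠ p := fun h' => hI (h.trans h'.symm)
              simp [h, hxg, hyg, hne]
            · simp [h]]
      rw [Finset.sum_ite_eq]
      simp
    rw [this, hR, Matrix.sub_apply]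
    ring

end Strips

end Summit.PneNP.PneNP.Theorems.CnfIdealGenLengthRankDefectRepresentationsAnchorStrips
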